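import Summits.CriticalPhenomena.PercolationContinuityZ3.Theorems.PercNearOneGluingNoHeavyLowerTailFrontierDecRowsRow44CutVertex
import Mathlib.Tactic.Linarith
import HarnessLib

/-!
# Row 15 across a cut vertex isolating `y` (route `PercNearOneGluingNoHeavy`, supports-only; prim-l12-p6 g15)

Companion of `…FrontierDecRowsRow15ThreeOneCutA` (lone `a`) and `…FrontierDecRowsRow44ThreeOneCut`.  Frontier dec row 15 is
`E₃(D[ab|c], D[ac|y], D[b|y]) ≥ 0`.  Here the cut vertex `h` separates `{a,b,c}` (colour `true`) from `y` (colour `false`).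

THEOREM (`sahiE3_row15_nonneg_of_threeOneCut_y`).  If every positive-weight edge avoiding `h` is monochromatic for such a colouring and row 15 is
non-negative at `(a,b,c,h)`, then row 15 is non-negative at `(a,b,c,y)`.
PROOF.  Near side: `X = {a≁c} ∩ {b≁c}`, `U = {a ↔ h} ∪ {c ↔ h}`, `V = {b ↔ h}`; far side: `ρ = P(h ↔ y)`.  The glued events are `D[ab|c] = X`,
`D[ac|y] = (U ∧ W)ᶜ`, `D[b|y] = (V ∧ W)ᶜ` (`W = {h ↔ y}` on the far side, independent of the near side), and the hypothesis row is `E₃(X, Uᶜ, Vᶜ)`.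
Expanding in `ρ`:  **`E₃(row 15 at (a,b,c,y)) = ρ(1−ρ)·[ (P(X∩U)+P(X∩V)−P(X∩(U∪V))) + Cov(X, (U∪V)ᶜ) ] + ρ²·E₃(row 15 at (a,b,c,h))`**;
the first bracket is non-negative by sub-additivity and Harris (`X`, `(U∪V)ᶜ` decreasing; `prodBernoulli_harris_lower`).  ∎
Recorded in `run/shared/lean/prim/prim-l12/FROM-prim-l12-p6-g15-ROW44-CUT-VERTICES.md` §8.2.  No definitions, no named facts, no sorries.
-/

noncomputable section

namespace Summit.CriticalPhenomena.PercolationContinuityZ3.Theorems.FrontierDecRows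

open MeasureTheory CovTransferCert E3GroupSepCert
open Literature.Probability.Percolation Literature.Probability.LatticeModels

variable {n : ℕ}

/-- The row-15 lone-`y` identity in real variables: `r = P(h ↔ y)`, `x = P(X)`, `u = P(U)`, `v = P(V)`, `w = P(U ∪ V)`, `xu, xv, xw` the joint
probabilities with `X`; sub-additivity, Harris and the hypothesis row give the glued row. [this work] -/
theorem row15_threeOneCutY_ineq (r x u v w xu xv xw : ℝ) (hr0 : 0 ≤ r) (hr1 : r ≤ 1) (hsub : xw ≤ xu + xv)
    (hH : x * (1 - w) ≤ x - xw)
    (h15 : 0 ≤ 2 * (x - xw) + x * (1 - u) * (1 - v) - (x * (1 - w) + (1 - u) * (x - xv) + (1 - v) * (x - xu))) :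
    0 ≤ 2 * (x - xw * r) + x * (1 - u * r) * (1 - v * r) -
      (x * (1 - w * r) + (1 - u * r) * (x - xv * r) + (1 - v * r) * (x - xu * r)) := by
  have key : 2 * (x - xw * r) + x * (1 - u * r) * (1 - v * r) -
      (x * (1 - w * r) + (1 - u * r) * (x - xv * r) + (1 - v * r) * (x - xu * r)) =
      r * (1 - r) * ((xu + xv - xw) + ((x - xw) - x * (1 - w))) +
      r ^ 2 * (2 * (x - xw) + x * (1 - u) * (1 - v) - (x * (1 - w) + (1 - u) * (x - xv) + (1 - v) * (x - xu))) := by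
    ring
  rw [key]
  have t1 := mul_nonneg (mul_nonneg hr0 (sub_nonneg.2 hr1)) (add_nonneg (sub_nonneg.2 hsub) (sub_nonneg.2 hH))
  have t2 := mul_nonneg (sq_nonneg r) h15
  linarith

set_option maxHeartbeats 1600000 in
/-- **Row 15 across a cut vertex isolating `y`.**  `a, b, c` coloured `true`, `y` coloured `false`, every positive-weight edge avoiding `h` monochromatic:
row 15 at `(a,b,c,h)` implies row 15 at `(a,b,c,y)` (exact identity: `ρ(1−ρ)·[Harris + inclusion–exclusion slack] + ρ²·row 15 at (a,b,c,h)`). [this work] -/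
theorem sahiE3_row15_nonneg_of_threeOneCut_y (w : Sym2 (Fin n) → unitInterval) (a b c y h : Fin n) (side : Fin n → Bool)
    (ha : side a = true) (hb : side b = true) (hc : side c = true) (hy : side y = false)
    (hw : ∀ u v : Fin n, u ≠ h → v ≠ h → side u ≠ side v → w s(u, v) = 0)
    (h15 : 0 ≤ sahiE3 (prodBernoulli w) (connEvent (row 15 n (a, b, c, h)).1) (connEvent (row 15 n (a, b, c, h)).2.1)
      (connEvent (row 15 n (a, b, c, h)).2.2)) :
    0 ≤ sahiE3 (prodBernoulli w) (connEvent (row 15 n (a, b, c, y)).1) (connEvent (row 15 n (a, b, c, y)).2.1)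
      (connEvent (row 15 n (a, b, c, y)).2.2) := by
  classical
  have hrow : row 15 n (a, b, c, y) = (sep [a, b] [c], sep [a, c] [y], sep [b] [y]) := rfl
  have hrow' : row 15 n (a, b, c, h) = (sep [a, b] [c], sep [a, c] [h], sep [b] [h]) := rfl
  simp only [hrow, connEvent_sep]
  simp only [hrow', connEvent_sep] at h15
  set μ := prodBernoulli w with hμ
  have neY : ∀ x, side x = true → x ≠ y := fun x hx e => by rw [e, hy] at hx; exact Bool.false_ne_true hx
  obtain ⟨hay, hby, hcy⟩ : a ≠ y ∧ b ≠ y ∧ c ≠ y := ⟨neY a ha, neY b hb, neY c hc⟩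
  set F₁ : Finset (Sym2 (Fin n)) := Finset.univ.filter (fun e => ∀ u ∈ e, side u = true ∨ u = h) with hF₁
  set F₂ : Finset (Sym2 (Fin n)) :=
    Finset.univ.filter (fun e => (∀ u ∈ e, side u = false ∨ u = h) ∧ ¬ ∀ u ∈ e, u = h) with hF₂
  have mem₁ : ∀ e, e ∈ F₁ ↔ ∀ u ∈ e, side u = true ∨ u = h := fun e => by rw [hF₁, Finset.mem_filter]; simp
  have mem₂ : ∀ e, e ∈ F₂ ↔ (∀ u ∈ e, side u = false ∨ u = h) ∧ ¬ ∀ u ∈ e, u = h := fun e => by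
    rw [hF₂, Finset.mem_filter]; simp
  have hdisj : Disjoint F₁ F₂ := by
    rw [Finset.disjoint_left]; intro e h1 h2; rw [mem₁] at h1; rw [mem₂] at h2
    apply h2.2
    intro u hu
    rcases h1 u hu with h1 | h1
    · rcases h2.1 u hu with h2 | h2
      · rw [h1] at h2; exact absurd h2 (by decide)
      · exact h2
    · exact h1
  set D : Finset (Sym2 (Fin n)) := F₁ ∪ F₂ with hD
  have hwD : ∀ e, e ∉ D → w e = 0 := by
    intro e he
    rw [hD, Finset.mem_union, not_or, mem₁, mem₂] at he
    obtain ⟨h1, h2⟩ := he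
    induction e using Sym2.ind with
    | h u v =>
      have key : u ≠ h ∧ v ≠ h ∧ side u ≠ side v := by
        by_cases hu : u = h
        · subst hu
          exfalso
          by_cases hv : v = u
          · exact h1 fun x hx => Or.inr (by rcases Sym2.mem_iff.1 hx with e | e <;> [exact e; exact e.trans hv])
          · cases hsv : side v
            · exact h2 ⟨fun x hx => by rcases Sym2.mem_iff.1 hx with e | e <;> [exact Or.inr e; exact Or.inl (e ▸ hsv)],
                fun hall => hv (hall v (Sym2.mem_iff.2 (Or.inr rfl)))⟩
            · exact h1 fun x hx => by rcases Sym2.mem_iff.1 hx with e | e <;> [exact Or.inr e; exact Or.inl (e ▸ hsv)]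
        · by_cases hv : v = h
          · subst hv
            exfalso
            cases hsu : side u
            · exact h2 ⟨fun x hx => by rcases Sym2.mem_iff.1 hx with e | e <;> [exact Or.inl (e ▸ hsu); exact Or.inr e],
                fun hall => hu (hall u (Sym2.mem_iff.2 (Or.inl rfl)))⟩
            · exact h1 fun x hx => by rcases Sym2.mem_iff.1 hx with e | e <;> [exact Or.inl (e ▸ hsu); exact Or.inr e]
          · refine ⟨hu, hv, fun hse => ?_⟩
            cases hsu : side u
            · exact h2 ⟨fun x hx => by
                  rcases Sym2.mem_iff.1 hx with e | e <;> [exact Or.inl (e ▸ hsu); exact Or.inl (e ▸ (hse ▸ hsu))],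
                fun hall => hu (hall u (Sym2.mem_iff.2 (Or.inl rfl)))⟩
            · exact h1 fun x hx => by
                rcases Sym2.mem_iff.1 hx with e | e <;> [exact Or.inl (e ▸ hsu); exact Or.inl (e ▸ (hse ▸ hsu))]
      exact hw u v key.1 key.2.1 key.2.2
  have hT : ∀ ω : Set (Sym2 (Fin n)), ∀ v u u', (openGraph (ω ∩ ↑F₁)).Adj v u → (openGraph (ω ∩ ↑F₂)).Adj v u' → v = h := by
    intro ω v u u' h1 h2
    rw [openGraph_adj] at h1 h2
    have e1 := (mem₁ _).1 (Finset.mem_coe.1 h1.1.2) v (Sym2.mem_iff.2 (Or.inl rfl))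
    have e2 := ((mem₂ _).1 (Finset.mem_coe.1 h2.1.2)).1 v (Sym2.mem_iff.2 (Or.inl rfl))
    rcases e1 with e1 | e1
    · rcases e2 with e2 | e2
      · rw [e1] at e2; exact absurd e2 (by decide)
      · exact e2
    · exact e1
  have iso₂ : ∀ ω : Set (Sym2 (Fin n)), ∀ x, side x = true → x ≠ h → ∀ u, ¬ (openGraph (ω ∩ ↑F₂)).Adj x u := by
    intro ω x hx hxh u hadj
    rw [openGraph_adj] at hadj
    rcases ((mem₂ _).1 (Finset.mem_coe.1 hadj.1.2)).1 x (Sym2.mem_iff.2 (Or.inl rfl)) with e | e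
    · rw [hx] at e; exact Bool.noConfusion e
    · exact hxh e
  have iso₁ : ∀ ω : Set (Sym2 (Fin n)), ∀ x, side x = false → x ≠ h → ∀ u, ¬ (openGraph (ω ∩ ↑F₁)).Adj x u := by
    intro ω x hx hxh u hadj
    rw [openGraph_adj] at hadj
    rcases (mem₁ _).1 (Finset.mem_coe.1 hadj.1.2) x (Sym2.mem_iff.2 (Or.inl rfl)) with e | e
    · rw [hx] at e; exact Bool.noConfusion e
    · exact hxh e
  have isoH : ∀ ω : Set (Sym2 (Fin n)), h ≠ h → ∀ u, ¬ (openGraph (ω ∩ ↑F₂)).Adj h u := fun ω hh => absurd rfl hh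
  have hsup : ∀ ω : Set (Sym2 (Fin n)), openGraph (ω ∩ ↑D) = openGraph (ω ∩ ↑F₁) ⊔ openGraph (ω ∩ ↑F₂) := by
    intro ω
    rw [hD, Finset.coe_union, Set.inter_union_distrib_left]
    exact SimpleGraph.fromEdgeSet_union _ _
  have pl : ∀ ω : Set (Sym2 (Fin n)), ∀ x z, side x = true → side z = true →
      ((openGraph (ω ∩ ↑D)).Reachable x z ↔ (openGraph (ω ∩ ↑F₁)).Reachable x z) := by
    intro ω x z hx hz; rw [hsup ω]; exact reachable_sup_iff_left (hT ω) (iso₂ ω x hx) (iso₂ ω z hz)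
  have plh : ∀ ω : Set (Sym2 (Fin n)), ∀ x, side x = true →
      ((openGraph (ω ∩ ↑D)).Reachable x h ↔ (openGraph (ω ∩ ↑F₁)).Reachable x h) := by
    intro ω x hx; rw [hsup ω]; exact reachable_sup_iff_left (hT ω) (iso₂ ω x hx) (isoH ω)
  have pc : ∀ ω : Set (Sym2 (Fin n)), ∀ x, side x = true → x ≠ y →
      ((openGraph (ω ∩ ↑D)).Reachable x y ↔
        (openGraph (ω ∩ ↑F₁)).Reachable x h ∧ (openGraph (ω ∩ ↑F₂)).Reachable h y) := by
    intro ω x hx hxy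
    rw [hsup ω]
    exact reachable_sup_iff_cross (hT ω) (iso₂ ω x hx) (iso₁ ω y hy) hxy
  set Eac : Set (Set (Sym2 (Fin n))) := {ω | ω ∩ ↑F₁ ∈ ((openConn a c)ᶜ : Set (Set (Sym2 (Fin n))))} with hEac
  set Ebc : Set (Set (Sym2 (Fin n))) := {ω | ω ∩ ↑F₁ ∈ ((openConn b c)ᶜ : Set (Set (Sym2 (Fin n))))} with hEbc
  set Ha : Set (Set (Sym2 (Fin n))) := {ω | ω ∩ ↑F₁ ∈ (openConn a h : Set (Set (Sym2 (Fin n))))} with hHa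
  set Hb : Set (Set (Sym2 (Fin n))) := {ω | ω ∩ ↑F₁ ∈ (openConn b h : Set (Set (Sym2 (Fin n))))} with hHb
  set Hc : Set (Set (Sym2 (Fin n))) := {ω | ω ∩ ↑F₁ ∈ (openConn c h : Set (Set (Sym2 (Fin n))))} with hHc
  set EY : Set (Set (Sym2 (Fin n))) := {ω | ω ∩ ↑F₂ ∈ (openConn h y : Set (Set (Sym2 (Fin n))))} with hEY
  set X : Set (Set (Sym2 (Fin n))) := {ω | ∀ x ∈ [a, b], ∀ z ∈ [c], ω ∉ openConn x z} with hX
  set Y : Set (Set (Sym2 (Fin n))) := {ω | ∀ x ∈ [a, c], ∀ z ∈ [y], ω ∉ openConn x z} with hY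
  set Z : Set (Set (Sym2 (Fin n))) := {ω | ∀ x ∈ [b], ∀ z ∈ [y], ω ∉ openConn x z} with hZ
  set Yh : Set (Set (Sym2 (Fin n))) := {ω | ∀ x ∈ [a, c], ∀ z ∈ [h], ω ∉ openConn x z} with hYh
  set Zh : Set (Set (Sym2 (Fin n))) := {ω | ∀ x ∈ [b], ∀ z ∈ [h], ω ∉ openConn x z} with hZh
  have tX : {ω : Set (Sym2 (Fin n)) | ω ∩ ↑D ∈ X} = Eac ∩ Ebc := by
    ext ω
    simp only [hX, hEac, hEbc, Set.mem_setOf_eq, Set.mem_inter_iff, Set.mem_compl_iff, openConn, List.mem_cons,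
      List.mem_nil_iff, or_false, forall_eq_or_imp, forall_eq]
    rw [pl ω a c ha hc, pl ω b c hb hc]
  have tY : {ω : Set (Sym2 (Fin n)) | ω ∩ ↑D ∈ Y} = ((Ha ∪ Hc) ∩ EY)ᶜ := by
    ext ω
    simp only [hY, hHa, hHc, hEY, Set.mem_setOf_eq, Set.mem_inter_iff, Set.mem_union, Set.mem_compl_iff, openConn, List.mem_cons,
      List.mem_nil_iff, or_false, forall_eq_or_imp, forall_eq]
    rw [pc ω a ha hay, pc ω c hc hcy]
    tauto
  have tZ : {ω : Set (Sym2 (Fin n)) | ω ∩ ↑D ∈ Z} = (Hb ∩ EY)ᶜ := by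
    ext ω
    simp only [hZ, hHb, hEY, Set.mem_setOf_eq, Set.mem_inter_iff, Set.mem_compl_iff, openConn, List.mem_singleton, forall_eq]
    rw [pc ω b hb hby]
  have tYh : {ω : Set (Sym2 (Fin n)) | ω ∩ ↑D ∈ Yh} = (Ha ∪ Hc)ᶜ := by
    ext ω
    simp only [hYh, hHa, hHc, Set.mem_setOf_eq, Set.mem_union, Set.mem_compl_iff, openConn, List.mem_cons,
      List.mem_nil_iff, or_false, forall_eq_or_imp, forall_eq]
    rw [plh ω a ha, plh ω c hc]
    tauto
  have tZh : {ω : Set (Sym2 (Fin n)) | ω ∩ ↑D ∈ Zh} = Hbᶜ := by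
    ext ω
    simp only [hZh, hHb, Set.mem_setOf_eq, Set.mem_compl_iff, openConn, List.mem_singleton, forall_eq]
    rw [plh ω b hb]
  have thin : ∀ A : Set (Set (Sym2 (Fin n))), μ.real A = μ.real {ω | ω ∩ ↑D ∈ A} :=
    fun A => real_eq_real_setOf_inter_mem w D hwD A
  have pre_inter : ∀ P Q : Set (Set (Sym2 (Fin n))),
      {ω : Set (Sym2 (Fin n)) | ω ∩ ↑D ∈ P ∩ Q} = {ω | ω ∩ ↑D ∈ P} ∩ {ω | ω ∩ ↑D ∈ Q} := fun P Q => rfl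
  have ms : ∀ A : Set (Set (Sym2 (Fin n))), MeasurableSet A := fun A => (Set.toFinite _).measurableSet
  have detY : DeterminedBy EY (↑F₁ : Set (Sym2 (Fin n)))ᶜ := by
    rw [determinedBy_iff]
    intro ω ω' hω
    have hsub : (↑F₂ : Set (Sym2 (Fin n))) ⊆ (↑F₁ : Set (Sym2 (Fin n)))ᶜ := fun e he he1 =>
      Finset.disjoint_left.1 hdisj (Finset.mem_coe.1 he1) (Finset.mem_coe.1 he)
    have : ω ∩ ↑F₂ = ω' ∩ ↑F₂ := by
      rw [← Set.inter_eq_self_of_subset_right hsub, ← Set.inter_assoc, ← Set.inter_assoc, hω]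
    simp only [hEY, Set.mem_setOf_eq, this]
  have indep : ∀ S : Set (Set (Sym2 (Fin n))), (∀ ω ω' : Set (Sym2 (Fin n)), ω ∩ ↑F₁ = ω' ∩ ↑F₁ → (ω ∈ S ↔ ω' ∈ S)) →
      μ.real (S ∩ EY) = μ.real S * μ.real EY :=
    fun S hS => prodBernoulli_real_inter_of_determinedBy w F₁ ((determinedBy_iff S _).2 hS) detY (ms _) (ms _)
  have sd : ∀ S : Set (Set (Sym2 (Fin n))), (∃ P : Set (Set (Sym2 (Fin n))), S = {ω | ω ∩ ↑F₁ ∈ P}) →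
      ∀ ω ω' : Set (Sym2 (Fin n)), ω ∩ ↑F₁ = ω' ∩ ↑F₁ → (ω ∈ S ↔ ω' ∈ S) := by
    rintro S ⟨P, rfl⟩ ω ω' hω; simp only [Set.mem_setOf_eq, hω]
  have cpl : ∀ S : Set (Set (Sym2 (Fin n))), μ.real Sᶜ = 1 - μ.real S := by
    intro S; rw [Set.compl_eq_univ_sdiff, measureReal_sdiff (Set.subset_univ _) (ms _)]; simp [hμ]
  have mC : ∀ S H : Set (Set (Sym2 (Fin n))), μ.real (S ∩ Hᶜ) = μ.real S - μ.real (S ∩ H) := by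
    intro S H
    have e : S ∩ Hᶜ = S \ (S ∩ H) := by ext ω; simp only [Set.mem_inter_iff, Set.mem_compl_iff, Set.mem_sdiff]; tauto
    rw [e, measureReal_sdiff Set.inter_subset_left (ms _)]
  have eX : μ.real X = μ.real (Eac ∩ Ebc) := by rw [thin, tX]
  have eY : μ.real Y = 1 - μ.real (Ha ∪ Hc) * μ.real EY := by
    rw [thin, tY, cpl, indep (Ha ∪ Hc) (sd _ ⟨openConn a h ∪ openConn c h, rfl⟩)]
  have eZ : μ.real Z = 1 - μ.real Hb * μ.real EY := by
    rw [thin, tZ, cpl, indep Hb (sd _ ⟨openConn b h, rfl⟩)]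
  have eYZ : μ.real (Y ∩ Z) = 1 - μ.real (Ha ∪ Hc ∪ Hb) * μ.real EY := by
    rw [thin, pre_inter, tY, tZ]
    have e : ((Ha ∪ Hc) ∩ EY)ᶜ ∩ (Hb ∩ EY)ᶜ = ((Ha ∪ Hc ∪ Hb) ∩ EY)ᶜ := by
      ext ω; simp only [Set.mem_inter_iff, Set.mem_union, Set.mem_compl_iff]; tauto
    rw [e, cpl, indep (Ha ∪ Hc ∪ Hb) (sd _ ⟨openConn a h ∪ openConn c h ∪ openConn b h, rfl⟩)]
  have eXY : μ.real (X ∩ Y) = μ.real (Eac ∩ Ebc) - μ.real (Eac ∩ Ebc ∩ (Ha ∪ Hc)) * μ.real EY := by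
    rw [thin, pre_inter, tX, tY]
    have e : (Eac ∩ Ebc) ∩ ((Ha ∪ Hc) ∩ EY)ᶜ = (Eac ∩ Ebc) \ ((Eac ∩ Ebc ∩ (Ha ∪ Hc)) ∩ EY) := by
      ext ω; simp only [Set.mem_inter_iff, Set.mem_union, Set.mem_compl_iff, Set.mem_sdiff]; tauto
    rw [e, measureReal_sdiff (fun ω hω => hω.1.1) (ms _),
      indep (Eac ∩ Ebc ∩ (Ha ∪ Hc)) (sd _ ⟨(openConn a c)ᶜ ∩ (openConn b c)ᶜ ∩ (openConn a h ∪ openConn c h), rfl⟩)]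
  have eXZ : μ.real (X ∩ Z) = μ.real (Eac ∩ Ebc) - μ.real (Eac ∩ Ebc ∩ Hb) * μ.real EY := by
    rw [thin, pre_inter, tX, tZ]
    have e : (Eac ∩ Ebc) ∩ (Hb ∩ EY)ᶜ = (Eac ∩ Ebc) \ ((Eac ∩ Ebc ∩ Hb) ∩ EY) := by
      ext ω; simp only [Set.mem_inter_iff, Set.mem_compl_iff, Set.mem_sdiff]; tauto
    rw [e, measureReal_sdiff (fun ω hω => hω.1.1) (ms _),
      indep (Eac ∩ Ebc ∩ Hb) (sd _ ⟨(openConn a c)ᶜ ∩ (openConn b c)ᶜ ∩ openConn b h, rfl⟩)]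
  have eXYZ : μ.real (X ∩ Y ∩ Z) = μ.real (Eac ∩ Ebc) - μ.real (Eac ∩ Ebc ∩ (Ha ∪ Hc ∪ Hb)) * μ.real EY := by
    rw [thin, pre_inter, pre_inter, tX, tY, tZ]
    have e : (Eac ∩ Ebc) ∩ ((Ha ∪ Hc) ∩ EY)ᶜ ∩ (Hb ∩ EY)ᶜ = (Eac ∩ Ebc) \ ((Eac ∩ Ebc ∩ (Ha ∪ Hc ∪ Hb)) ∩ EY) := by
      ext ω; simp only [Set.mem_inter_iff, Set.mem_union, Set.mem_compl_iff, Set.mem_sdiff]; tauto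
    rw [e, measureReal_sdiff (fun ω hω => hω.1.1) (ms _),
      indep (Eac ∩ Ebc ∩ (Ha ∪ Hc ∪ Hb)) (sd _ ⟨(openConn a c)ᶜ ∩ (openConn b c)ᶜ ∩ (openConn a h ∪ openConn c h ∪ openConn b h), rfl⟩)]
  have i1 : μ.real (X ∩ Yh ∩ Zh) = μ.real (Eac ∩ Ebc) - μ.real (Eac ∩ Ebc ∩ (Ha ∪ Hc ∪ Hb)) := by
    rw [thin, pre_inter, pre_inter, tX, tYh, tZh]
    have e : (Eac ∩ Ebc) ∩ (Ha ∪ Hc)ᶜ ∩ Hbᶜ = (Eac ∩ Ebc) ∩ (Ha ∪ Hc ∪ Hb)ᶜ := by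
      ext ω; simp only [Set.mem_inter_iff, Set.mem_union, Set.mem_compl_iff]; tauto
    rw [e, mC]
  have i2 : μ.real Yh = 1 - μ.real (Ha ∪ Hc) := by rw [thin, tYh, cpl]
  have i3 : μ.real Zh = 1 - μ.real Hb := by rw [thin, tZh, cpl]
  have i4 : μ.real (Yh ∩ Zh) = 1 - μ.real (Ha ∪ Hc ∪ Hb) := by rw [thin, pre_inter, tYh, tZh, ← Set.compl_union, cpl]
  have i5 : μ.real (X ∩ Zh) = μ.real (Eac ∩ Ebc) - μ.real (Eac ∩ Ebc ∩ Hb) := by rw [thin, pre_inter, tX, tZh, mC]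
  have i6 : μ.real (X ∩ Yh) = μ.real (Eac ∩ Ebc) - μ.real (Eac ∩ Ebc ∩ (Ha ∪ Hc)) := by rw [thin, pre_inter, tX, tYh, mC]
  rw [sahiE3_def, i1, i4, i5, i6, eX, i2, i3] at h15
  have loConn : ∀ u v : Fin n,
      IsLowerSet {ω : Set (Sym2 (Fin n)) | ω ∩ ↑F₁ ∈ ((openConn u v)ᶜ : Set (Set (Sym2 (Fin n))))} := by
    intro u v ω ω' hle hω
    simp only [Set.mem_setOf_eq, Set.mem_compl_iff] at hω ⊢
    exact fun h' => hω (isUpperSet_openConn u v (Set.inter_subset_inter_left _ hle) h')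
  have upConn : ∀ u : Fin n, IsUpperSet {ω : Set (Sym2 (Fin n)) | ω ∩ ↑F₁ ∈ (openConn u h : Set (Set (Sym2 (Fin n))))} := by
    intro u ω ω' hle hω
    simp only [Set.mem_setOf_eq] at hω ⊢
    exact isUpperSet_openConn u h (Set.inter_subset_inter_left _ hle) hω
  have loX : IsLowerSet (Eac ∩ Ebc) := (loConn a c).inter (loConn b c)
  have loW : IsLowerSet (Ha ∪ Hc ∪ Hb)ᶜ := (((upConn a).union (upConn c)).union (upConn b)).compl
  have hH : μ.real (Eac ∩ Ebc) * μ.real (Ha ∪ Hc ∪ Hb)ᶜ ≤ μ.real ((Eac ∩ Ebc) ∩ (Ha ∪ Hc ∪ Hb)ᶜ) :=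
    prodBernoulli_harris_lower w loX loW (ms _) (ms _)
  rw [cpl, mC] at hH
  have hsub : μ.real (Eac ∩ Ebc ∩ (Ha ∪ Hc ∪ Hb)) ≤ μ.real (Eac ∩ Ebc ∩ (Ha ∪ Hc)) + μ.real (Eac ∩ Ebc ∩ Hb) := by
    rw [Set.inter_union_distrib_left (Eac ∩ Ebc) (Ha ∪ Hc) Hb]; exact measureReal_union_le _ _
  have hρ0 : 0 ≤ μ.real EY := measureReal_nonneg
  have hρ1 : μ.real EY ≤ 1 := (measureReal_mono (Set.subset_univ EY)).trans (le_of_eq (by simp [hμ]))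
  rw [sahiE3_def, eXYZ, eX, eY, eZ, eYZ, eXZ, eXY]
  exact row15_threeOneCutY_ineq _ _ _ _ _ _ _ _ hρ0 hρ1 hsub hH h15

end Summit.CriticalPhenomena.PercolationContinuityZ3.Theorems.FrontierDecRows

end
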